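import Literature.Computability.MetaComplexity.GGM
import Literature.Computability.Complexity.CircuitClassesUniformProofs
import Literature.Computability.Complexity.BrickAlgebra
import Literature.Computability.Complexity.StringEquality
import Literature.Computability.Complexity.FPStringBricks
import Literature.Computability.Complexity.LengthCompare
import HarnessLib

/-!
# Small circuits for a polynomial-time generator family and its GGM tree (proofs)

Part of the proof architecture of the named fact `AllenderEtAl2006_MCSP_universalInverter`
(`MCSPUniversalInverter.lean`; Allender–Buhrman–Koucký–van Melkebeek–Ronneburger 2006, Thm. 45
with §4.2). The printed proof of Thm. 45 (p. 24 of the author version) stretches the generator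
`G_y` by "the construction of [GGM86]" to `G'_y : {0,1}ⁿ → {0,1}^{2ᵏ}` "and shows that if
`z = G'_y(x)`, then `SIZE(z) = (n + k)^{O(1)}`. We can pick `k = O(log n)` such that for each `x`
and polynomially bounded `y`" the stretched output fails the `KT`/circuit-size test. This file
proves that size estimate in the tree's circuit model, uniformly in the parameter `y`:

* `exists_poly_cktSize_apply_getD` — for `G ∈ FP` there is a polynomial `Q` such that for every
  parameter `y`, seed length `ℓ` and position `t`, the map `s ↦ bit t of G ⟨y, s⟩`
  (`s ∈ {0,1}^ℓ` on the input wires, `y` and `t` hard-wired) has `B₂`-circuits of size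
  `Q(|y| + t + ℓ)` (`P ⊆ P/poly`, `P_subset_PPoly_holds`, applied to the bit language
  `{⟨⟨y, 1ᵗ⟩, s⟩ : G ⟨y, s⟩[t] = 1} ∈ P` of `G`, then `exists_cktSize_boolPair_of_mem_PPoly` and
  hard-wiring, `CktSize.hardwire`);
* `exists_poly_circuitSizeOver_ggmLab_le` — hence, for every polynomial bound `r` on `|y|`, a
  polynomial `S` with: the leaf-bit function `u ↦ (label of leaf u of the depth-k GGM tree with
  root x and halves of G_y as step maps) j₀` has circuit complexity `≤ k · S(ℓ) + 2` for all
  `|y| ≤ r(ℓ)`, `x ∈ {0,1}^ℓ`, `j₀` (`circuitSizeOver_ggm_le` of `MetaComplexity/GGM.lean`).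

The halves of `G ⟨y, s⟩ ∈ {0,1}^{2ℓ}` are read positionally: half `b` at position `j < ℓ` is bit
`cond b (ℓ + j) j` (missing bits read as `0`). Theorems only.

## References

* E. Allender, H. Buhrman, M. Koucký, D. van Melkebeek, D. Ronneburger, *Power from random
  strings*, SIAM J. Comput. 35(6) (2006) [AllenderEtAl2006]: proof of Thm. 45 (p. 24).
* A. A. Razborov, S. Rudich, *Natural proofs*, JCSS 55 (1997) [RazborovRudich1997]: proof of
  Thm. 4.1 (the GGM-stretched generator has small circuits).
* S. Arora, B. Barak, *Computational Complexity: A Modern Approach*, CUP 2009 [AroraBarak2009]: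
  Thm. 6.6 (`P ⊆ P/poly`), §23.3 p. 592 (hard-wiring the seed).
-/

namespace Literature.Computability.MetaComplexity

open _root_.Computability Complexity Complexity.Brick

/-- Reading one bit positionally: `(l.drop t).take 1 = [1]` iff `l.getD t 0 = 1`. [folklore] -/
private theorem take_one_drop_eq_singleton_true_iff (l : List Bool) (t : ℕ) :
    (l.drop t).take 1 = [true] ↔ l.getD t false = true := by
  by_cases h : t < l.length
  · rw [List.take_one_drop_eq_of_lt_length h, List.getD_eq_getElem _ _ h]
    simp
  · rw [not_lt] at h
    rw [List.drop_eq_nil_of_le h, List.getD_eq_default _ _ h]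
    simp

/-- **Bits of a polynomial-time generator family have small circuits, uniformly in the
parameter.** For `G ∈ FP` there is a polynomial `Q` such that for every `y`, `ℓ`, `t` the map
`s ↦ G ⟨y, s⟩[t]` on `s ∈ {0,1}^ℓ` (missing bits read as `0`) has `B₂`-circuits of size
`≤ Q(|y| + t + ℓ)`: the bit language `{⟨⟨y, a⟩, s⟩ : G ⟨y, s⟩[|a|] = 1}` is in `P`
(`bitAtFn`, brick algebra), hence in `P/poly` (`P_subset_PPoly_holds`); its circuits on paired
inputs (`exists_cktSize_boolPair_of_mem_PPoly`) with the first component `⟨y, 1ᵗ⟩` hard-wired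
(`CktSize.hardwire`) compute the bit. [cite: AroraBarak2009, Thm. 6.6 and §23.3 p. 592]
[cite: RazborovRudich1997, Thm. 4.1 proof] -/
theorem exists_poly_cktSize_apply_getD {G : List Bool → List Bool} (hG : G ∈ FP) :
    ∃ Q : Polynomial ℕ, ∀ (y : List Bool) (ℓ t : ℕ),
      CktSize B2 (fun (s : Fin ℓ → Bool) (_ : Unit) =>
        (G (boolPair y (List.ofFn s))).getD t false) (Q.eval (y.length + t + ℓ)) := by
  classical
  -- the bit function `φ ⟨⟨y, a⟩, x⟩ = (G ⟨y, x⟩).drop |a| |>.take 1` and the bit language `L`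
  let φ : List Bool → List Bool :=
    bitAtFn ∘ fanoutFn (sndF ∘ fstF) (G ∘ fanoutFn (fstF ∘ fstF) sndF)
  let L : Language Bool := {w | φ w = [true]}
  have hφ_apply : ∀ y a x : List Bool,
      φ (boolPair (boolPair y a) x) = ((G (boolPair y x)).drop a.length).take 1 := by
    intro y a x
    simp [φ]
  have hff : (fstF ∘ fstF : List Bool → List Bool) ∈ FP :=
    comp_mem_FP (g := fstF) (f := fstF) fstF_mem_FP fstF_mem_FP
  have hsf : (sndF ∘ fstF : List Bool → List Bool) ∈ FP :=
    comp_mem_FP (g := sndF) (f := fstF) sndF_mem_FP fstF_mem_FP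
  have hGp : (G ∘ fanoutFn (fstF ∘ fstF) sndF : List Bool → List Bool) ∈ FP :=
    comp_mem_FP (g := G) (f := fanoutFn (fstF ∘ fstF) sndF) hG (fanoutFn_mem_FP hff sndF_mem_FP)
  have hφ : φ ∈ FP :=
    comp_mem_FP (g := bitAtFn) (f := fanoutFn (sndF ∘ fstF) (G ∘ fanoutFn (fstF ∘ fstF) sndF))
      bitAtFn_mem_FP (fanoutFn_mem_FP hsf hGp)
  -- `L ∈ P`, with the one-bit decider `w ↦ [φ w = [1]]`
  have hdec : (eqPairFn ∘ fanoutFn φ (fun _ => [true]) : List Bool → List Bool) ∈ FP :=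
    comp_mem_FP (g := eqPairFn) (f := fanoutFn φ fun _ => [true]) eqPairFn_mem_FP
      (fanoutFn_mem_FP hφ (const_mem_FP [true]))
  have hLP : L ∈ Classes.P := by
    refine mem_P_of_mem_FP hdec L fun w => ⟨fun hw => ?_, fun hw => ?_⟩
    · have hw' : φ w = [true] := hw
      simp [eqPairFn_boolPair, hw']
    · have hw' : φ w ≠ [true] := hw
      simp [eqPairFn_boolPair, hw']
  -- circuits for `L` on paired inputs, first component hard-wired
  obtain ⟨q, hq⟩ := exists_cktSize_boolPair_of_mem_PPoly (P_subset_PPoly_holds hLP)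
  refine ⟨(4 * Polynomial.X + 6) + q.comp (4 * Polynomial.X + 6) + 2, fun y ℓ t => ?_⟩
  set c : List Bool := boolPair y (List.replicate t true) with hc
  have hcl : c.length = 2 * y.length + 2 + t := by simp [hc]
  -- swap the two wire blocks, then hard-wire the (now second) block to the bits of `c`
  have h1 := ((hq c.length ℓ).rewire (ι' := Fin ℓ ⊕ Fin c.length) Sum.swap).hardwire
    (fun i : Fin c.length => c[i])
  have hsize : 2 * c.length + 2 + ℓ + q.eval (2 * c.length + 2 + ℓ) + 2 ≤
      ((4 * Polynomial.X + 6) + q.comp (4 * Polynomial.X + 6) + 2).eval (y.length + t + ℓ) := by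
    have hN : 2 * c.length + 2 + ℓ ≤ 4 * (y.length + t + ℓ) + 6 := by rw [hcl]; omega
    have hqN := TM2Iter.eval_mono q hN
    simp only [Polynomial.eval_add, Polynomial.eval_mul, Polynomial.eval_ofNat,
      Polynomial.eval_X, Polynomial.eval_comp]
    omega
  refine (h1.of_le hsize).congr fun s u => ?_
  -- the hard-wired circuit reads bit `t` of `G ⟨y, s⟩`
  simp only [Sum.swap_inl, Sum.swap_inr, Sum.elim_inl, Sum.elim_inr, Fin.getElem_fin,
    List.ofFn_getElem]
  have hmem : boolPair c (List.ofFn s) ∈ L ↔ (G (boolPair y (List.ofFn s))).getD t false = true := by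
    show φ (boolPair c (List.ofFn s)) = [true] ↔ _
    rw [hc, hφ_apply, List.length_replicate, take_one_drop_eq_singleton_true_iff]
  cases hG' : (G (boolPair y (List.ofFn s))).getD t false
  · refine (Set.notMem_iff_boolIndicator _ _).1 fun hm => ?_
    have h := hmem.1 hm
    rw [hG'] at h
    exact Bool.false_ne_true h
  · exact (Set.mem_iff_boolIndicator _ _).1 (hmem.2 hG')

/-- **The GGM-stretched generator has small circuits** (ABK⁺06, proof of Thm. 45:
"`SIZE(z) = (n + k)^{O(1)}`"; Razborov–Rudich 1997, proof of Thm. 4.1). For `G ∈ FP` and a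
polynomial bound `r` there is a polynomial `S` such that for all `ℓ`, all `|y| ≤ r(ℓ)`, every
root `x ∈ {0,1}^ℓ`, depth `k` and read-out position `j₀`, the leaf-bit function of the depth-`k`
GGM tree whose two step maps are the halves of `s ↦ G ⟨y, s⟩` — `u ↦ (ggmLab g x k u) j₀` — has
`B₂`-circuit complexity `≤ k · S(ℓ) + 2` (`circuitSizeOver_ggm_le`, with every bit of both
halves in size `Q(r(ℓ) + 3ℓ)` by `exists_poly_cktSize_apply_getD`).
[cite: AllenderEtAl2006, Thm. 45 (proof, p. 24)] [cite: RazborovRudich1997, Thm. 4.1 proof]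
[cite: AroraBarak2009, §23.3 p. 592] -/
theorem exists_poly_circuitSizeOver_ggmLab_le {G : List Bool → List Bool} (hG : G ∈ FP)
    (r : Polynomial ℕ) :
    ∃ S : Polynomial ℕ, ∀ (ℓ k : ℕ) (y : List Bool), y.length ≤ r.eval ℓ →
      ∀ (x : Fin ℓ → Bool) (j₀ : Fin ℓ),
        circuitSizeOver B2 (fun u : Fin k → Bool =>
          ggmLab (fun (b : Bool) (s : Fin ℓ → Bool) (j : Fin ℓ) =>
            (G (boolPair y (List.ofFn s))).getD (cond b (ℓ + j) j) false) x k u j₀) ≤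
          k * S.eval ℓ + 2 := by
  obtain ⟨Q, hQ⟩ := exists_poly_cktSize_apply_getD hG
  refine ⟨2 * (Polynomial.X * Q.comp (r + 3 * Polynomial.X)) + Polynomial.X * 4,
    fun ℓ k y hy x j₀ => ?_⟩
  -- every bit of both halves has circuits of size `Q(r(ℓ) + 3ℓ)`
  have hg : ∀ (b : Bool) (j : Fin ℓ), CktSize B2
      (fun (s : Fin ℓ → Bool) (_ : Unit) =>
        (G (boolPair y (List.ofFn s))).getD (cond b (ℓ + j) j) false)
      (Q.eval (r.eval ℓ + 3 * ℓ)) := by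
    intro b j
    refine (hQ y ℓ (cond b (ℓ + j) j)).of_le (TM2Iter.eval_mono Q ?_)
    have hj := j.isLt
    cases b <;> simp <;> omega
  have h := circuitSizeOver_ggm_le _ hg x j₀ k
  have hS : (2 * (Polynomial.X * Q.comp (r + 3 * Polynomial.X)) + Polynomial.X * 4).eval ℓ =
      2 * (ℓ * Q.eval (r.eval ℓ + 3 * ℓ)) + ℓ * 4 := by
    simp [Polynomial.eval_comp]
  rw [hS]
  exact h

end Literature.Computability.MetaComplexity
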